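import Literature.AlgebraicGeometry.ShimuraVarieties.UnitaryBallSpecialCurveFrame
import Literature.AlgebraicGeometry.ShimuraVarieties.UnitaryBallSpecialCurveSubscheme
import HarnessLib

/-!
# The special curve of a totally positive line as a `UnitaryBallUniformisationDatum 1` (compatible special source)

Topic `AlgebraicGeometry/ShimuraVarieties`; namespace
`Literature.AlgebraicGeometry.ShimuraVarieties.UnitaryBallQuotientDatum`.  THEOREMS ONLY.  Assembly of
`UnitaryBallSpecialCurveSubscheme` (the special curve `Γ_W∖𝔹_W` of a compact ball-quotient datum is, at injective
level, a smooth projective closed subscheme `κ : Z ↪ X` analytified by `Γ_W∖𝔹_W`) with the frame algebra of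
`UnitaryBallSpecialCurveFrame`: for a frame `ᵗσ(B)·H·B = J⋆ ⊕ᶠ J⊥` of the datum's hermitian space with `W = E·(B e₃)`
totally positive, and a subgroup `Γ₁ ≤ GL₂(E)` supplied with the LEVEL JUNCTION («`Γ₁` is the restriction of the
stabiliser `Γ_W` along the frame»: `B(γ₁ ⊕ 1)B⁻¹ ∈ Γ` for `γ₁ ∈ Γ₁`, and every `γ ∈ Γ_W` is of this form — the
currency of `UnitaryGroupFrameEmbeddingLevels`, where `Γ₁` is an adelic arithmetic level of `U(J⋆)`), we PROVE

* **`exists_specialCurveDatum`** — there is a `B₁ : UnitaryBallUniformisationDatum 1 Z` on the special curve with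
  `B₁.Hℂ = J⋆^{τ₁}` (CONE-framed by `J⋆`), `B₁.Γ^{τ₁} = Γ₁^{τ₁}`, and which is a COMPATIBLE SPECIAL SOURCE of the
  surface datum along `W` in the sense of `IsCompatibleSpecialSource` (`UnitaryBallH1RestrictionToSpecialCurves`):
  `gram` `Mᴴ H^{τ₁} M = J⋆^{τ₁}`, `orthogonal`, `group`, and `unif_comp : κ(ℂ) (B₁.unif v) = D.unif (M v)` for the
  embedding matrix `M = τ₁(B·(e₁|e₂))`; together with `Set.range κ = D.specialSubvariety W`.

The uniformisation of `B₁` is `v ↦ φ₁(Γ_W · coneChart (M v))` on the negative cone of `J⋆^{τ₁}`; its continuity,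
openness, surjectivity and fibres (`Γ₁·ℂˣ`-orbits) come from the closed-embedding picture of
`UnitaryBallSpecialCurveEmbedding`, and its HOLOMORPHY needs no manifold calculus: a regular function on an affine
open of `Z` is, near any complex point, the pull-back of a regular function on `X` along the closed immersion `κ`
(`HodgeTheory.exists_eval_eq_of_stalkMap_surjective`), whose composite with `D.unif ∘ M` is holomorphic by the surface
datum's own `differentiableOn_unif`.  This is leaf L5 of the census `CENSUS-R2-2-Q2` (road (ii) «embedded-curve
descent» of the cell `hodgecm-mathlib`), the per-piece datum consumed by the R2-5/R2-7 assembly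
`UnitaryShimuraCurveRecordOfEmbedding` (`RecordSystemGS.pieces`).  Everything is PROVED; no named facts, no definitions.

References: N. Bergeron, J. Millson, C. Moeglin, Acta Math. 216 (2016), Introduction §§1.1, 1.7, Part 2 §§1.3, 3.1–3.3;
S. Kudla, J. Millson, Publ. Math. IHÉS 71 (1990), Lemma 1.1; Y. Liu, Camb. J. Math. 9 (2021), proof of Thm. 4.15
(l. 2207); J.-P. Serre, GAGA (1956), §2; P. Deligne, *Travaux de Shimura* (1971), Prop. 1.15.
HC_CM is proved only modulo the 7 printed citations until rung 0 closes; nothing here is in a registered cone.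
-/

set_option autoImplicit false

noncomputable section

open scoped Manifold ContDiff Topology ComplexOrder
open Matrix Complex ComplexConjugate NumberField Set Function MulAction CategoryTheory AlgebraicGeometry
open Literature.Geometry.ComplexHyperbolic
open Literature.Geometry.ComplexHyperbolic.BallModel
open Literature.NumberTheory.Automorphic
open Literature.NumberTheory.Automorphic.UnitaryGroup (finSum reindexGL blockDiagGL)
open Literature.NumberTheory.Transcendental

namespace Literature.AlgebraicGeometry.ShimuraVarieties

open Literature.AlgebraicGeometry.Motives

namespace UnitaryBallUniformisationDatum

variable {X : SchemeOver ℂ} (D : UnitaryBallUniformisationDatum 2 X) (𝔣 : D.SylvesterFrame)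
variable (B : GL (Fin 3) D.E) (Jstar : Matrix (Fin 2) (Fin 2) D.E) (Jperp : Matrix (Fin 1) (Fin 1) D.E)

/-! ### §1 The block-diagonal conjugate `B(γ₁ ⊕ 1)B⁻¹` -/

/-- The matrix of `B·(γ₁ ⊕ 1)·B⁻¹`. [cite: Kudla1984, §1] -/
theorem coe_conj_blockDiag (γ₁ : GL (Fin 2) D.E) :
    ((B * reindexGL finSumFinEquiv (blockDiagGL (γ₁, (1 : GL (Fin 1) D.E))) * B⁻¹ : GL (Fin 3) D.E) :
        Matrix (Fin 3) (Fin 3) D.E) =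
      (B : Matrix (Fin 3) (Fin 3) D.E) * finSum 2 1 (γ₁ : Matrix (Fin 2) (Fin 2) D.E) 1 *
        ((B⁻¹ : GL (Fin 3) D.E) : Matrix (Fin 3) (Fin 3) D.E) := by
  rw [Units.val_mul, Units.val_mul]
  rfl

/-- `γ₁ ↦ B·(γ₁ ⊕ 1)·B⁻¹` as a group homomorphism `GL₂(E) →* GL₃(E)`. [cite: Kudla1984, §1] -/
theorem conj_blockDiag_eq_hom (γ₁ : GL (Fin 2) D.E) :
    B * reindexGL finSumFinEquiv (blockDiagGL (γ₁, (1 : GL (Fin 1) D.E))) * B⁻¹ =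
      ((MulAut.conj B).toMonoidHom.comp ((reindexGL (S := D.E) finSumFinEquiv).comp
        ((blockDiagGL (S := D.E) (n₁ := Fin 2) (n₂ := Fin 1)).comp (MonoidHom.inl _ _)))) γ₁ :=
  rfl

/-- `γ₁ ↦ B·(γ₁ ⊕ 1)·B⁻¹` is injective. [cite: Kudla1984, §1] -/
theorem conj_blockDiag_injective :
    Injective fun γ₁ : GL (Fin 2) D.E ↦ B * reindexGL finSumFinEquiv (blockDiagGL (γ₁, (1 : GL (Fin 1) D.E))) * B⁻¹ := by
  intro γ₁ γ₁' h
  have h1 : reindexGL (S := D.E) finSumFinEquiv (blockDiagGL (γ₁, (1 : GL (Fin 1) D.E))) =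
      reindexGL finSumFinEquiv (blockDiagGL (γ₁', (1 : GL (Fin 1) D.E))) := by
    simpa only [mul_left_inj, mul_right_inj] using h
  have h2 := UnitaryGroup.blockDiagGL_injective (UnitaryGroup.reindexGL_injective (S := D.E) finSumFinEquiv h1)
  exact (Prod.mk.inj h2).1

/-- `B·(γ₁ ⊕ 1)·B⁻¹` FIXES the last column `B e₃`. [cite: Kudla1984, §1] -/
theorem conj_blockDiag_mulVec_lastCol (γ₁ : GL (Fin 2) D.E) :
    ((B * reindexGL finSumFinEquiv (blockDiagGL (γ₁, (1 : GL (Fin 1) D.E))) * B⁻¹ : GL (Fin 3) D.E) :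
        Matrix (Fin 3) (Fin 3) D.E) *ᵥ (fun i => (B : Matrix (Fin 3) (Fin 3) D.E) i (Fin.last 2)) =
      fun i => (B : Matrix (Fin 3) (Fin 3) D.E) i (Fin.last 2) := by
  rw [coe_conj_blockDiag, D.lastCol_eq_mulVec_append B, mulVec_mulVec, Matrix.mul_assoc, ← Units.val_mul,
    inv_mul_cancel, Units.val_one, Matrix.mul_one, ← mulVec_mulVec, UnitaryGroup.finSum_mulVec_append, mulVec_zero,
    one_mulVec]

/-- `B·(γ₁ ⊕ 1)·B⁻¹` restricts to `γ₁` along `M`: `(B(γ₁ ⊕ 1)B⁻¹)^{τ₁} · M = M · γ₁^{τ₁}`. [cite: Kudla1984, §1] -/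
theorem map_conj_blockDiag_mul_embMatrix (γ₁ : GL (Fin 2) D.E) :
    (((B * reindexGL finSumFinEquiv (blockDiagGL (γ₁, (1 : GL (Fin 1) D.E))) * B⁻¹ : GL (Fin 3) D.E) :
        Matrix (Fin 3) (Fin 3) D.E).map D.E.subtype) *
        ((B : Matrix (Fin 3) (Fin 3) D.E).submatrix id Fin.castSucc).map D.E.subtype =
      ((B : Matrix (Fin 3) (Fin 3) D.E).submatrix id Fin.castSucc).map D.E.subtype *
        (γ₁ : Matrix (Fin 2) (Fin 2) D.E).map D.E.subtype := by
  rw [coe_conj_blockDiag]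
  exact D.map_conj_finSum_one_mul_embMatrix B γ₁

/-- `B·(γ₁ ⊕ 1)·B⁻¹` stabilises the line `W = E·(B e₃)` (when it lies in `Γ`). [cite: KudlaMillson1990, Lemma 1.1, p. 128] -/
theorem conj_blockDiag_mem_lineStab {γ₁ : GL (Fin 2) D.E}
    (hγ : B * reindexGL finSumFinEquiv (blockDiagGL (γ₁, (1 : GL (Fin 1) D.E))) * B⁻¹ ∈ D.Γ) :
    (⟨_, hγ⟩ : D.Γ) ∈ D.lineStab (D.E ∙ fun i => (B : Matrix (Fin 3) (Fin 3) D.E) i (Fin.last 2)) := by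
  set s : Fin 3 → D.E := fun i => (B : Matrix (Fin 3) (Fin 3) D.E) i (Fin.last 2) with hs
  have hfix : ∀ γ₁' : GL (Fin 2) D.E, ∀ x ∈ (D.E ∙ s),
      ((B * reindexGL finSumFinEquiv (blockDiagGL (γ₁', (1 : GL (Fin 1) D.E))) * B⁻¹ : GL (Fin 3) D.E) :
        Matrix (Fin 3) (Fin 3) D.E) *ᵥ x ∈ (D.E ∙ s) := by
    intro γ₁' x hx
    obtain ⟨a, rfl⟩ := Submodule.mem_span_singleton.1 hx
    rw [mulVec_smul, D.conj_blockDiag_mulVec_lastCol B γ₁']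
    exact Submodule.smul_mem _ a (Submodule.mem_span_singleton_self s)
  refine D.mem_lineStab_of_forall_mem (fun x hx ↦ hfix γ₁ x hx) fun x hx ↦ ?_
  have hinv : ((⟨_, hγ⟩ : D.Γ)⁻¹ : D.Γ) = ⟨B * reindexGL finSumFinEquiv (blockDiagGL (γ₁⁻¹, (1 : GL (Fin 1) D.E))) * B⁻¹,
      by simpa only [conj_blockDiag_eq_hom, map_inv] using D.Γ.inv_mem hγ⟩ := by
    apply Subtype.ext
    simp only [Subgroup.coe_inv, conj_blockDiag_eq_hom, map_inv]
  rw [hinv]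
  exact hfix γ₁⁻¹ x hx

end UnitaryBallUniformisationDatum

/-! ### §2 The datum of the special curve -/

namespace UnitaryBallQuotientDatum

open UnitaryBallUniformisationDatum

variable {X : SchemeOver ℂ} (D : UnitaryBallQuotientDatum 2 X) (𝔣 : D.SylvesterFrame)

/-- **The special curve of a totally positive line is a compatible uniformised special source** (at injective
level).  Let `ᵗσ(B)·H·B = J⋆ ⊕ᶠ J⊥` be a frame of the datum's hermitian space with `Re τ(J⊥₀₀) > 0` at every complex
embedding (so `W = E·(B e₃)` is a totally positive line and `M = τ₁(B·(e₁|e₂))` parametrises `W^⊥ ⊗ ℂ`), let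
`Γ₁ ≤ U(J⋆)(E)` be a congruence subgroup such that `B(γ₁ ⊕ 1)B⁻¹ ∈ Γ` for `γ₁ ∈ Γ₁` and every element of the stabiliser
`Γ_W` is of this form (the arithmetic level of the embedded Shimura curve), and assume the injectivity of the level
(`hinj`).  Then the reduced closed subscheme `κ : Z ↪ X` on the special subvariety of `W`
(`exists_specialCurveSubscheme`: smooth projective of dimension `1`) carries a `UnitaryBallUniformisationDatum 1 Z`
with Gram matrix `J⋆`, group `Γ₁`, uniformised by `v ↦ Γ_W·coneChart(M v)` on the negative cone of `J⋆^{τ₁}`, which is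
an `IsCompatibleSpecialSource` of the surface datum along `W` through `κ` and `M`.
[cite: BergeronMillsonMoeglin2016Balls, Part 2 §§3.1–3.3] [cite: KudlaMillson1990, Lemma 1.1, p. 128 and p. 133]
[cite: Liu2021, proof of Thm. 4.15 l. 2207] -/
theorem exists_specialCurveDatum (B : GL (Fin 3) D.E) (Jstar : Matrix (Fin 2) (Fin 2) D.E)
    (Jperp : Matrix (Fin 1) (Fin 1) D.E) (hB : formCongr (conjRingHom D.E) B D.H = finSum 2 1 Jstar Jperp)
    (hpos : ∀ τ : D.E →+* ℂ, 0 < (τ (Jperp 0 0)).re)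
    (Γ₁ : Subgroup (GL (Fin 2) D.E)) (hΓ₁ : IsCongruenceSubgroup (conjRingHom D.E) Jstar Γ₁)
    (hΓ₁Γ : ∀ γ₁ ∈ Γ₁, B * reindexGL finSumFinEquiv (blockDiagGL (γ₁, (1 : GL (Fin 1) D.E))) * B⁻¹ ∈ D.Γ)
    (hΓΓ₁ : ∀ γ : D.Γ, γ ∈ D.lineStab (D.E ∙ fun i => (B : Matrix (Fin 3) (Fin 3) D.E) i (Fin.last 2)) →
      ∃ γ₁ ∈ Γ₁, (γ : GL (Fin 3) D.E) = B * reindexGL finSumFinEquiv (blockDiagGL (γ₁, (1 : GL (Fin 1) D.E))) * B⁻¹)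
    (hinj : ∀ γ : D.Γ, (∃ z ∈ D.specialBall 𝔣 {fun i => (B : Matrix (Fin 3) (Fin 3) D.E) i (Fin.last 2)},
        D.ballRep 𝔣 γ • z ∈ D.specialBall 𝔣 {fun i => (B : Matrix (Fin 3) (Fin 3) D.E) i (Fin.last 2)}) →
      γ ∈ D.lineStab (D.E ∙ fun i => (B : Matrix (Fin 3) (Fin 3) D.E) i (Fin.last 2))) :
    ∃ (Z : SchemeOver ℂ) (κ : Z ⟶ X) (_ : IsClosedImmersion κ.left) (_ : IsReduced Z.left)
      (B₁ : UnitaryBallUniformisationDatum 1 Z),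
      B₁.Hℂ = Jstar.map D.E.subtype ∧
      B₁.Γ.map (Matrix.GeneralLinearGroup.map (B₁.τ₁ : B₁.E →+* ℂ)) =
        Γ₁.map (Matrix.GeneralLinearGroup.map (D.E.subtype : D.E →+* ℂ)) ∧
      IsCompatibleSpecialSource D.toUnitaryBallUniformisationDatum
        (D.E ∙ fun i => (B : Matrix (Fin 3) (Fin 3) D.E) i (Fin.last 2)) B₁ κ
        (((B : Matrix (Fin 3) (Fin 3) D.E).submatrix id Fin.castSucc).map D.E.subtype) ∧
      Set.range κ.left = D.specialSubvariety (D.E ∙ fun i => (B : Matrix (Fin 3) (Fin 3) D.E) i (Fin.last 2)) := by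
  classical
  have hJ : D.E.subtype (Jperp 0 0) ≠ 0 := fun h ↦ by
    have := hpos D.E.subtype; rw [h, Complex.zero_re] at this; exact lt_irrefl _ this
  -- the last column as a `DiscVec` (an opaque variable `sv`, so that the instances on `𝔹_W`, `Γ_W∖𝔹_W` are found)
  obtain ⟨sv, hsv⟩ : ∃ sv : D.DiscVec 𝔣, (sv.1 : Fin 3 → D.E) = fun i => (B : Matrix (Fin 3) (Fin 3) D.E) i (Fin.last 2) :=
    ⟨⟨_, D.lastCol_discVec 𝔣 B Jstar Jperp hB (hpos D.E.subtype)⟩, rfl⟩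
  rw [← hsv] at hΓΓ₁ hinj
  rw [← hsv]
  set M : Matrix (Fin 3) (Fin 2) ℂ := ((B : Matrix (Fin 3) (Fin 3) D.E).submatrix id Fin.castSucc).map D.E.subtype
    with hM
  -- the totally positive line, the special curve subscheme
  have hW : IsTotallyPositive (conjRingHom D.E) D.H (D.E ∙ sv.1) := by
    rw [hsv]; exact D.isTotallyPositive_span_lastCol B Jstar Jperp hB hpos
  obtain ⟨Z, κ, hκ, hred, φ₁, hsm, hφ₁, hrange, hcompat⟩ := D.exists_specialCurveSubscheme 𝔣 sv hW hinj
  haveI := hκ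
  -- frame lemmas restated on `sv`
  have hstab : ∀ {γ₁ : GL (Fin 2) D.E}
      (hγ : B * reindexGL finSumFinEquiv (blockDiagGL (γ₁, (1 : GL (Fin 1) D.E))) * B⁻¹ ∈ D.Γ),
      (⟨_, hγ⟩ : D.Γ) ∈ D.lineStab (D.E ∙ sv.1) := fun hγ ↦ by
    rw [hsv]; exact D.conj_blockDiag_mem_lineStab B hγ
  -- the map `negCone J⋆^{τ₁} → 𝔹_W`, `v ↦ coneChart (M v)`
  have hcone : ∀ {v : Fin 2 → ℂ}, v ∈ negCone (Jstar.map D.E.subtype) → M *ᵥ v ∈ D.cone :=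
    fun {v} hv ↦ (D.embMatrix_mulVec_mem_cone_iff B Jstar Jperp hB v).2 hv
  have hmemW : ∀ {v : Fin 2 → ℂ} (hv : v ∈ negCone (Jstar.map D.E.subtype)),
      D.coneChart 𝔣 ⟨M *ᵥ v, hcone hv⟩ ∈ D.specialBall 𝔣 {sv.1} := fun hv ↦ by
    rw [hsv]; exact D.coneChart_embMatrix_mem_specialBall 𝔣 B Jstar Jperp hB hv
  let ψ : {v : Fin 2 → ℂ // v ∈ negCone (Jstar.map D.E.subtype)} → D.specialDisc 𝔣 sv := fun v ↦
    ⟨D.coneChart 𝔣 ⟨M *ᵥ v.1, hcone v.2⟩, hmemW v.2⟩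
  have hψval : ∀ v, (ψ v).1 = D.coneChart 𝔣 ⟨M *ᵥ v.1, hcone v.2⟩ := fun v ↦ rfl
  have hψc : Continuous ψ := by
    refine Continuous.subtype_mk ((D.continuous_coneChart 𝔣).comp (Continuous.subtype_mk ?_ _)) _
    exact continuous_const.matrix_mulVec continuous_subtype_val
  -- the uniformisation
  let u₁ : (Fin 2 → ℂ) → ComplexPoints Z := fun v ↦
    if hv : v ∈ negCone (Jstar.map D.E.subtype) then φ₁ (D.specialCurveMk 𝔣 sv (ψ ⟨v, hv⟩))
    else φ₁ (D.specialCurveMk 𝔣 sv (Classical.arbitrary _))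
  have hu₁ : ∀ {v : Fin 2 → ℂ} (hv : v ∈ negCone (Jstar.map D.E.subtype)),
      u₁ v = φ₁ (D.specialCurveMk 𝔣 sv (ψ ⟨v, hv⟩)) := fun hv ↦ dif_pos hv
  have hrestrict : (negCone (Jstar.map D.E.subtype)).restrict u₁ = φ₁ ∘ D.specialCurveMk 𝔣 sv ∘ ψ := by
    funext v; exact hu₁ v.2
  -- `unif_comp`: `κ(ℂ) (u₁ v) = D.unif (M v)`
  have hcomp : ∀ {v : Fin 2 → ℂ} (hv : v ∈ negCone (Jstar.map D.E.subtype)),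
      AlgPoints.map κ (u₁ v) = D.unif (M *ᵥ v) := by
    intro v hv
    rw [hu₁ hv, hcompat, specialCurveMap_mk, hψval, quotientSurfaceHomeomorph_mk, ← D.unif_eq_ballUnifMap_coneChart 𝔣]
  -- every point of the sub-disc lifts to the cone of `J⋆`
  have hlift : ∀ z : D.specialDisc 𝔣 sv, ∃ v : {v : Fin 2 → ℂ // v ∈ negCone (Jstar.map D.E.subtype)},
      M *ᵥ v.1 = ((D.coneLift 𝔣 z.1 : D.cone) : Fin 3 → ℂ) ∧ ψ v = z := by
    intro z
    obtain ⟨v, hv, hvz⟩ := D.exists_coneLift_eq_embMatrix_mulVec 𝔣 B Jstar Jperp hB hJ (z := z.1)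
      (by rw [← hsv]; exact z.2)
    refine ⟨⟨v, hv⟩, hvz, specialDisc.ext D.toUnitaryBallUniformisationDatum 𝔣 ?_⟩
    rw [hψval]
    have : (⟨M *ᵥ v, hcone hv⟩ : D.cone) = D.coneLift 𝔣 z.1 := Subtype.ext hvz
    rw [this, D.coneChart_coneLift 𝔣]
  -- a linear left inverse of `M`
  obtain ⟨L, hL⟩ : ∃ L : (Fin 3 → ℂ) →ₗ[ℂ] (Fin 2 → ℂ), L.comp (Matrix.mulVecLin M) = LinearMap.id :=
    LinearMap.exists_leftInverse_of_injective _
      (LinearMap.ker_eq_bot.2 (D.embMatrix_mulVec_injective B))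
  have hLM : ∀ v : Fin 2 → ℂ, L (M *ᵥ v) = v := fun v ↦ by
    simpa using LinearMap.congr_fun hL v
  -- torsion-freeness of `Γ₁`
  have htf : ∀ γ₁ ∈ Γ₁, IsOfFinOrder γ₁ → γ₁ = 1 := by
    intro γ₁ hγ₁ hfin
    have hfin' : IsOfFinOrder (B * reindexGL finSumFinEquiv (blockDiagGL (γ₁, (1 : GL (Fin 1) D.E))) * B⁻¹) := by
      rw [D.conj_blockDiag_eq_hom B γ₁]; exact MonoidHom.isOfFinOrder _ hfin
    have h1 := D.torsionFree _ (hΓ₁Γ γ₁ hγ₁) hfin'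
    apply D.conj_blockDiag_injective B
    change B * reindexGL finSumFinEquiv (blockDiagGL (γ₁, (1 : GL (Fin 1) D.E))) * B⁻¹ =
      B * reindexGL finSumFinEquiv (blockDiagGL (1, (1 : GL (Fin 1) D.E))) * B⁻¹
    rw [h1, D.conj_blockDiag_eq_hom B 1, map_one]
  -- THE DATUM
  refine ⟨Z, κ, hκ, hred,
    { E := D.E
      H := Jstar
      conj_H_apply := D.conj_subform_apply B Jstar Jperp hB
      anisotropic := D.anisotropic_subform B Jstar Jperp hB
      signature_τ₁ := D.exists_sylvesterFrame_subform 𝔣 B Jstar Jperp hB (hpos D.E.subtype)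
      posDef_of_ne := D.posDef_map_subform B Jstar Jperp hB
      Γ := Γ₁
      isCongruenceSubgroup := hΓ₁
      torsionFree := htf
      unif := u₁
      continuousOn_unif := ?_
      isOpenMap_unif := ?_
      surjOn_unif := ?_
      unif_eq_unif_iff := ?_
      differentiableOn_unif := ?_
      isSmoothProjective := hsm }, rfl, rfl, ?_, hrange⟩
  · -- continuity on the cone
    rw [continuousOn_iff_continuous_restrict, hrestrict]
    exact hφ₁.isHomeomorph.continuous.comp (continuous_quotient_mk'.comp hψc)
  · -- openness on the cone: `φ₁`, the projection and `ψ` are open (`ψ` has continuous local sections)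
    rw [hrestrict]
    refine hφ₁.isHomeomorph.isOpenMap.comp ((Literature.Geometry.Manifold.QuotientManifold.isLocalHomeomorph_mk
      (G := D.lineStab (D.E ∙ sv.1)) (M := D.specialDisc 𝔣 sv)).isOpenMap.comp ?_)
    rw [isOpenMap_iff_nhds_le]
    intro v
    obtain ⟨c, hc, hcv⟩ := D.exists_coneLift_coneChart_eq_smul 𝔣 ⟨M *ᵥ v.1, hcone v.2⟩
    -- the section `z ↦ c⁻¹ • L (coneLift z)`
    have hsec_mem : ∀ z : D.specialDisc 𝔣 sv,
        c⁻¹ • L ((D.coneLift 𝔣 z.1 : D.cone) : Fin 3 → ℂ) ∈ negCone (Jstar.map D.E.subtype) := by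
      intro z
      obtain ⟨w, hwz, -⟩ := hlift z
      rw [← hwz, hLM]
      exact smul_mem_negCone (inv_ne_zero hc) w.2
    let σ₁ : D.specialDisc 𝔣 sv → {v : Fin 2 → ℂ // v ∈ negCone (Jstar.map D.E.subtype)} :=
      fun z ↦ ⟨c⁻¹ • L ((D.coneLift 𝔣 z.1 : D.cone) : Fin 3 → ℂ), hsec_mem z⟩
    have hσ₁c : Continuous σ₁ := by
      refine Continuous.subtype_mk (((L.continuous_of_finiteDimensional).comp
        (continuous_subtype_val.comp ((D.continuous_coneLift 𝔣).comp continuous_subtype_val))).const_smul c⁻¹) _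
    have hψσ₁ : ∀ z, ψ (σ₁ z) = z := by
      intro z
      obtain ⟨w, hwz, -⟩ := hlift z
      apply specialDisc.ext D.toUnitaryBallUniformisationDatum 𝔣
      rw [hψval]
      conv_rhs => rw [← D.coneChart_coneLift 𝔣 z.1]
      refine (D.coneChart_eq_iff 𝔣 _ _).2 ⟨c⁻¹, inv_ne_zero hc, ?_⟩
      change M *ᵥ (c⁻¹ • L ((D.coneLift 𝔣 z.1 : D.cone) : Fin 3 → ℂ)) =
        c⁻¹ • ((D.coneLift 𝔣 z.1 : D.cone) : Fin 3 → ℂ)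
      rw [← hwz, hLM, mulVec_smul]
    have hσ₁ψ : σ₁ (ψ v) = v := by
      apply Subtype.ext
      change c⁻¹ • L ((D.coneLift 𝔣 (D.coneChart 𝔣 ⟨M *ᵥ v.1, hcone v.2⟩) : D.cone) : Fin 3 → ℂ) = v.1
      rw [hcv, map_smul, hLM, smul_smul, inv_mul_cancel₀ hc, one_smul]
    intro S hS
    have h1 : σ₁ ⁻¹' (ψ ⁻¹' S) ∈ 𝓝 (ψ v) := by
      apply hσ₁c.continuousAt.preimage_mem_nhds
      rw [hσ₁ψ]; exact hS
    refine Filter.mem_of_superset h1 fun z hz ↦ ?_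
    simpa only [Set.mem_preimage, hψσ₁] using hz
  · -- surjectivity onto `Z(ℂ)`
    intro P _
    obtain ⟨q, rfl⟩ := hφ₁.isHomeomorph.surjective P
    obtain ⟨z, rfl⟩ := Quotient.mk_surjective (s := orbitRel _ _) q
    obtain ⟨w, -, hψw⟩ := hlift z
    refine ⟨w.1, w.2, ?_⟩
    rw [hu₁ w.2, hψw]
  · -- fibres: `Γ₁ · ℂˣ`-orbits
    intro v hv w hw
    rw [hu₁ hv, hu₁ hw, hφ₁.isHomeomorph.injective.eq_iff]
    constructor
    · intro h
      obtain ⟨g, hg⟩ := Literature.Geometry.Manifold.QuotientManifold.mk_eq_mk_iff.1 h.symm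
      -- `g ∈ Γ_W` is `B(γ₁ ⊕ 1)B⁻¹`
      obtain ⟨γ₁, hγ₁, hgγ₁⟩ := hΓΓ₁ g.1 g.2
      have hval : D.ballRep 𝔣 g.1 • (ψ ⟨v, hv⟩).1 = (ψ ⟨w, hw⟩).1 := by
        rw [← specialDisc.val_smul]; exact congrArg Subtype.val hg
      rw [hψval, hψval, ← coneChart_act, D.coneChart_eq_iff 𝔣] at hval
      obtain ⟨c, hc, hcv⟩ := hval
      rw [coe_toRealPoints_smul] at hcv
      change ((((g.1 : D.Γ) : GL (Fin 3) D.E) : Matrix (Fin 3) (Fin 3) D.E).map D.τ₁) *ᵥ (M *ᵥ v) = c • (M *ᵥ w)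
        at hcv
      rw [hgγ₁, mulVec_mulVec, D.map_conj_blockDiag_mul_embMatrix B γ₁, ← mulVec_mulVec, ← mulVec_smul] at hcv
      exact ⟨γ₁, hγ₁, c, hc, D.embMatrix_mulVec_injective B hcv⟩
    · rintro ⟨γ₁, hγ₁, c, hc, hcv⟩
      have hγ := hΓ₁Γ γ₁ hγ₁
      set g : D.lineStab (D.E ∙ sv.1) := ⟨⟨_, hγ⟩, hstab hγ⟩ with hgdef
      refine (Literature.Geometry.Manifold.QuotientManifold.mk_eq_mk_iff.2 ⟨g, ?_⟩).symm
      apply specialDisc.ext D.toUnitaryBallUniformisationDatum 𝔣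
      rw [specialDisc.val_smul, hψval, hψval, ← coneChart_act, D.coneChart_eq_iff 𝔣]
      refine ⟨c, hc, ?_⟩
      rw [coe_toRealPoints_smul]
      change (((B * reindexGL finSumFinEquiv (blockDiagGL (γ₁, (1 : GL (Fin 1) D.E))) * B⁻¹ : GL (Fin 3) D.E) :
        Matrix (Fin 3) (Fin 3) D.E).map D.τ₁) *ᵥ (M *ᵥ v) = c • (M *ᵥ w)
      rw [mulVec_mulVec, D.map_conj_blockDiag_mul_embMatrix B γ₁, ← mulVec_mulVec, hcv, mulVec_smul]
  · -- holomorphy: regular functions on `Z` are locally pulled back from `X` along `κ`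
    intro U f v hv
    obtain ⟨hvneg, hvU⟩ := hv
    obtain ⟨O, r, N, hPN, hN⟩ := Literature.AlgebraicGeometry.HodgeTheory.exists_eval_eq_of_stalkMap_surjective κ
      (u₁ v) (κ.left.stalkMap_surjective _) U f hvU
    -- the comparison function, holomorphic near `v`
    have hO : IsOpen (D.cone ∩ D.unif ⁻¹' {P : ComplexPoints X | P.pt ∈ (↑O : X.left.Opens)}) :=
      D.continuousOn_unif.isOpen_inter_preimage (isOpen_negCone _) (AlgPoints.isOpen_setOf_pt_mem _)
    have hMv : M *ᵥ v ∈ D.cone ∩ D.unif ⁻¹' {P : ComplexPoints X | P.pt ∈ (↑O : X.left.Opens)} := by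
      refine ⟨hcone hvneg, ?_⟩
      change (D.unif (M *ᵥ v)).pt ∈ (↑O : X.left.Opens)
      rw [← hcomp hvneg]
      exact (hN (u₁ v) hPN).1
    have hg' : DifferentiableAt ℂ (fun t : Fin 2 → ℂ ↦ AlgPoints.evalOrZero (↑O : X.left.Opens) r (D.unif (M *ᵥ t))) v := by
      have h1 := (D.differentiableOn_unif O r).differentiableAt (hO.mem_nhds hMv)
      have h2 : DifferentiableAt ℂ (fun t : Fin 2 → ℂ ↦ M *ᵥ t) v := by
        have : (fun t : Fin 2 → ℂ ↦ M *ᵥ t) = ⇑(Matrix.mulVecLin M).toContinuousLinearMap := by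
          funext t; simp
        rw [this]; exact (Matrix.mulVecLin M).toContinuousLinearMap.differentiableAt
      exact h1.comp v h2
    -- the two functions agree near `v` inside the domain
    have hnhds : {t : Fin 2 → ℂ | ∃ ht : t ∈ negCone (Jstar.map D.E.subtype), (u₁ t).pt ∈ N} ∈
        𝓝[negCone (Jstar.map D.E.subtype) ∩ u₁ ⁻¹' {P : ComplexPoints Z | P.pt ∈ (↑U : Z.left.Opens)}] v := by
      have hc : ContinuousWithinAt u₁ (negCone (Jstar.map D.E.subtype)) v := by
        have hcont : ContinuousOn u₁ (negCone (Jstar.map D.E.subtype)) := by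
          rw [continuousOn_iff_continuous_restrict, hrestrict]
          exact hφ₁.isHomeomorph.continuous.comp (continuous_quotient_mk'.comp hψc)
        exact hcont v hvneg
      have h1 : u₁ ⁻¹' {P : ComplexPoints Z | P.pt ∈ N} ∈ 𝓝[negCone (Jstar.map D.E.subtype)] v :=
        hc.preimage_mem_nhdsWithin ((AlgPoints.isOpen_setOf_pt_mem N).mem_nhds hPN)
      have h2 : negCone (Jstar.map D.E.subtype) ∈ 𝓝[negCone (Jstar.map D.E.subtype)] v := self_mem_nhdsWithin
      refine nhdsWithin_mono v Set.inter_subset_left (Filter.mem_of_superset (Filter.inter_mem h1 h2) ?_)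
      rintro t ⟨ht1, ht2⟩
      exact ⟨ht2, ht1⟩
    refine (hg'.differentiableWithinAt.congr_of_eventuallyEq ?_ ?_)
    · filter_upwards [hnhds] with t ht
      obtain ⟨htneg, htN⟩ := ht
      rw [(hN (u₁ t) htN).2, hcomp htneg]
    · rw [(hN (u₁ v) hPN).2, hcomp hvneg]
  · -- the compatible special source
    exact
      { gram := D.gram_of_map_eq B Jstar Jperp hB _ rfl
        orthogonal := fun w hw v ↦ D.hermForm_map_span_lastCol_embMatrix_mulVec B Jstar Jperp hB w
          (by rw [hsv] at hw; exact hw) v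
        group := fun γ₁ hγ₁ ↦ ⟨_, hΓ₁Γ γ₁ hγ₁, D.map_conj_blockDiag_mul_embMatrix B γ₁⟩
        unif_comp := fun v hv ↦ hcomp hv }

end UnitaryBallQuotientDatum

end Literature.AlgebraicGeometry.ShimuraVarieties

end
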